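import Summits.HodgeConjecture.HodgeConjecture.Theorems.F0P3cStCharTSUpDom            -- ★ p851529 (LH4-p01 g5) «UP-DOM★» — brings the (UP-DEF) currency (`finTau`, `finKappaAt`, `IsLocalNormPair`, `IsLocalStablyConjH`, `Gqs`)
import Literature.NumberTheory.Rogawski1990.FinExplicitTransferFactorConjRight      -- ★ p827714 (F0P3a-p01) «N1f-r»: `finKappaAt_conj_right`, `isLocalNormPair_conj_right`
import Literature.NumberTheory.Rogawski1990.Ch12Sec5                                -- ★ TR carpet: `EllipticData.UpSpec`, `IsClassFunOn`
import HarnessLib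

/-!
# F0 · P3c · line LH6 «StCharTS» — «UP-CLASS★»: under the (UP-DEF) field equation `α ↦ α^G = up α` is a CLASS FUNCTION on `U(Φ₃)(L⁺_v)` — the clause `UpSpec`.(2)
# (`IsClassFunOn 𝔇.regG (𝔇.up α)`, Rogawski 1990 §12.5 p. 183 «a class function on `G`») for EVERY `α`, from the conjugation invariance of each letter of the formula

Cell `pub/hodgecm-mathlib`, crux H413 = `stmt-HodgeConjecture-24833` (lane `--supports … --as helper`), route HCCMUnconditional; seat F0P3-p02 (g21); datum road of the (S-𝔇)
organ `stub_EllipticPackage` (`Cruxes/H413/Lines/F0_P3c_StCharTSPaydown.lean`), MAP v5 §3 row `up` («UpSpec (2)(3) … remain NAMED on that formula»).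
THEOREMS ONLY (no definition ∕ instance ∕ notation ∕ named fact ∕ `sorry`); ★-only imports.
HONEST LABEL: HC_CM is proved only modulo the 7 printed citations (2 remaining named inputs: hLiu418 = `stmt-HodgeConjecture-24832`, h413 = `stmt-HodgeConjecture-24833`)
until rung 0 closes; this file closes no organ and is COUNT-NEUTRAL: `UpSpec` [§12.5 p. 183] stays ONE named input (its clause (3), the transfer identity
`∫_G f·α^G dg = ∫_H f^H·α dh`, is the definition of `α^G` in print and is not touched here); the file pays clause (2) at the (UP-DEF) formula, for every `α`.

THE MATHEMATICS.  (UP-DEF): `α^G(x) = 0` off `G^r`, and at regular `x`, `α^G(x) = D_G(x)⁻¹ · Σ_q [q G-regular, q ↔ x] τ(q) D_H(q) κ(q, x) α(q)` (sum over stable classes `q` of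
`H_v`, evaluated at a fixed representative).  Under `x ↦ y x y⁻¹`: regularity is a class function (★ `isRegularElt_conj_iff`), `D_G` is (hypothesis `hDGcl` — at the concrete datum
the closed formula `|discr(charpoly)∕det²|^{1∕4}` of ★ DG-FIELD is a function of the characteristic polynomial, ★ `Matrix.charpoly_units_conj`), matching `q ↔ x` only sees the class of
`x` (★ `isLocalNormPair_conj_right`), and so does `κ(q, ·)` on matched pairs (★ `finKappaAt_conj_right`, [Rogawski1990 §4.3 p. 43; §14.6 p. 242]); `τ(q)`, `D_H(q)`, `α(q)` do not see
`x` at all.  Hence `α^G(y x y⁻¹) = α^G(x)` for ALL `x` (no regularity, stability or measurability hypothesis on `α`).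
* `up_conj_eq_of_upDef` — `𝔇.up α (y * x * y⁻¹) = 𝔇.up α x` for all `α x y`;
* `isClassFunOn_up_of_upDef` — `IsClassFunOn S (𝔇.up α)` for every `S` (the pen takes `S := 𝔇.regG`: the clause `UpSpec`.(2) verbatim);
* `DG_conj_eq_of_formula` — the hypothesis `hDGcl` DISCHARGED from the junction∕RUNG0 pin `eDG` (any formula that factors through `charpoly` and `det`).

## References
* [Rogawski1990] J. D. Rogawski, *Automorphic Representations of Unitary Groups in Three Variables*, Ann. of Math. Stud. 123 (1990): §12.5 p. 183 (`α^G` «is given by integration against a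
  class function on `G`»; LEMMA 12.5.1), §4.3 p. 43 (transfer factors are class functions in each variable), §4.9 pp. 54–55 (`D_G`, `τ`, `κ`), §14.6 p. 242.
* [LanglandsShelstad1987] R. P. Langlands, D. Shelstad, *On the definition of transfer factors*, Math. Ann. 278 (1987), §1–§2 — background (dependence on the conjugacy class only).
-/

set_option autoImplicit false
-- the mandated namespace has the single-problem summit's repeated segment (`HodgeConjecture.HodgeConjecture`)
set_option linter.dupNamespace false

noncomputable section

open MeasureTheory Filter Topology
open NumberField IsDedekindDomain
open scoped Matrix MatrixGroups Classical
open Literature.NumberTheory.Rogawski1990 Literature.NumberTheory.Automorphic Literature.NumberTheory.Automorphic.UnitaryGroup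
open Literature.NumberTheory.GaloisRepresentations

namespace Summit.HodgeConjecture.HodgeConjecture.Cruxes.H413.F0P3cStCharTSUpClass

variable (L : Type) [Field L] [NumberField L] [IsCMField L] (v : HeightOneSpectrum (𝓞 ↥(maximalRealSubfield L)))
    [MeasurableSpace (Gqs L v)] [∀ γ : Gqs L v, MeasurableSpace (Gqs L v ⧸ Subgroup.centralizer ({γ} : Set (Gqs L v)))]
    [MeasurableSpace (Gqs L v ⧸ Subgroup.center (Gqs L v))]

/-- **`D_G` is a class function whenever it is given by a formula in the characteristic polynomial and the determinant** — the shape of the junction∕RUNG0 pin `eDG`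
(`∀ g, 𝔇.DG g = Φ (charpoly g) (det g)` for the closed formula `Φ` of ★ DG-FIELD): then `𝔇.DG (y x y⁻¹) = 𝔇.DG x`. [cite: Rogawski1990, §4.9 p. 54] -/
theorem DG_conj_eq_of_formula
    {H : Type} [Group H] [TopologicalSpace H] [IsTopologicalGroup H] [MeasurableSpace H]
    (𝔇 : Ch12Sec5.EllipticData (Gqs L v) H)
    (Φ : Polynomial (UnitaryGroup.LocalRing L v) → UnitaryGroup.LocalRing L v → ℝ)
    (eDG : ∀ g : Gqs L v, 𝔇.DG g = Φ ((g.val : GL (Fin 3) (UnitaryGroup.LocalRing L v)).val.charpoly) ((g.val : GL (Fin 3) (UnitaryGroup.LocalRing L v)).val.det)) :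
    ∀ x y : Gqs L v, 𝔇.DG (y * x * y⁻¹) = 𝔇.DG x := by
  intro x y
  rw [eDG, eDG x]
  have hval : ((y * x * y⁻¹).val : GL (Fin 3) (UnitaryGroup.LocalRing L v)) =
      (y.val : GL (Fin 3) (UnitaryGroup.LocalRing L v)) * x.val * (y.val)⁻¹ := rfl
  rw [hval, Units.val_mul, Units.val_mul, Matrix.det_units_conj, Matrix.coe_units_inv, Matrix.charpoly_units_conj]

/-- **«UP-CLASS★» — `α^G(y x y⁻¹) = α^G(x)` under (UP-DEF)**, for EVERY `α : H_v → ℂ` and all `x y ∈ U(Φ₃)(L⁺_v)`, given that `D_G` is a class function (`hDGcl`, e.g. ★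
`DG_conj_eq_of_formula`): each letter of the (UP-DEF) formula is invariant under conjugation of `x` (★ `isRegularElt_conj_iff`, ★ `isLocalNormPair_conj_right`, ★ `finKappaAt_conj_right`).
[cite: Rogawski1990, §12.5 p. 183; §4.3 p. 43; §14.6 p. 242] -/
theorem up_conj_eq_of_upDef (μ : HeckeCharacter L)
    [MeasurableSpace ((UnitaryGroup.cmDatum L 2 (Matrix.of fun i j : Fin 2 => if i.val + j.val + 1 = 2 then (1 : L) else 0)).Local v ×
      (UnitaryGroup.cmDatum L 1 (Matrix.of fun i j : Fin 1 => if i.val + j.val + 1 = 1 then (1 : L) else 0)).Local v)]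
    (𝔇 : Ch12Sec5.EllipticData (Gqs L v)
      ((UnitaryGroup.cmDatum L 2 (Matrix.of fun i j : Fin 2 => if i.val + j.val + 1 = 2 then (1 : L) else 0)).Local v ×
        (UnitaryGroup.cmDatum L 1 (Matrix.of fun i j : Fin 1 => if i.val + j.val + 1 = 1 then (1 : L) else 0)).Local v))
    (hUp : ∀ (α : ((UnitaryGroup.cmDatum L 2 (Matrix.of fun i j : Fin 2 => if i.val + j.val + 1 = 2 then (1 : L) else 0)).Local v ×
        (UnitaryGroup.cmDatum L 1 (Matrix.of fun i j : Fin 1 => if i.val + j.val + 1 = 1 then (1 : L) else 0)).Local v) → ℂ) (x : Gqs L v),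
      𝔇.up α x =
        if IsRegularElt (x.val : GL (Fin 3) (UnitaryGroup.LocalRing L v)) then
          ((𝔇.DG x : ℂ))⁻¹ *
            ∑ᶠ q : Quot (IsLocalStablyConjH L v),
              (if IsLocalGRegular L v q.out ∧ IsLocalNormPair L (qsForm L) v q.out x then
                finTau L v q.out μ * (𝔇.DH q.out : ℂ) * ((finKappaAt L v (qsForm L) q.out x : ℤ) : ℂ) * α q.out
              else 0)
        else 0)
    (hDGcl : ∀ x y : Gqs L v, 𝔇.DG (y * x * y⁻¹) = 𝔇.DG x)
    (α : ((UnitaryGroup.cmDatum L 2 (Matrix.of fun i j : Fin 2 => if i.val + j.val + 1 = 2 then (1 : L) else 0)).Local v ×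
        (UnitaryGroup.cmDatum L 1 (Matrix.of fun i j : Fin 1 => if i.val + j.val + 1 = 1 then (1 : L) else 0)).Local v) → ℂ)
    (x y : Gqs L v) : 𝔇.up α (y * x * y⁻¹) = 𝔇.up α x := by
  have hval : ((y * x * y⁻¹).val : GL (Fin 3) (UnitaryGroup.LocalRing L v)) =
      (y.val : GL (Fin 3) (UnitaryGroup.LocalRing L v)) * x.val * (y.val)⁻¹ := rfl
  have hregiff : IsRegularElt ((y * x * y⁻¹).val : GL (Fin 3) (UnitaryGroup.LocalRing L v)) ↔
      IsRegularElt (x.val : GL (Fin 3) (UnitaryGroup.LocalRing L v)) := by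
    rw [hval]; exact isRegularElt_conj_iff _ _
  rw [hUp α (y * x * y⁻¹), hUp α x]
  by_cases hx : IsRegularElt (x.val : GL (Fin 3) (UnitaryGroup.LocalRing L v))
  · rw [if_pos (hregiff.2 hx), if_pos hx, hDGcl x y]
    congr 1
    refine finsum_congr fun q => ?_
    by_cases hm : IsLocalGRegular L v q.out ∧ IsLocalNormPair L (qsForm L) v q.out x
    · have hm' : IsLocalGRegular L v q.out ∧ IsLocalNormPair L (qsForm L) v q.out (y * x * y⁻¹) :=
        ⟨hm.1, (isLocalNormPair_conj_right L v (qsForm L) q.out x y).2 hm.2⟩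
      rw [if_pos hm', if_pos hm, finKappaAt_conj_right L v (qsForm L) q.out x y hm.2]
    · have hm' : ¬ (IsLocalGRegular L v q.out ∧ IsLocalNormPair L (qsForm L) v q.out (y * x * y⁻¹)) :=
        fun h => hm ⟨h.1, (isLocalNormPair_conj_right L v (qsForm L) q.out x y).1 h.2⟩
      rw [if_neg hm', if_neg hm]
  · rw [if_neg (fun h => hx (hregiff.1 h)), if_neg hx]

/-- **The clause `UpSpec`.(2) at the (UP-DEF) formula: `α^G` is a class function on every `S ⊆ G`** (the pen takes `S := 𝔇.regG`), for every `α`.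
[cite: Rogawski1990, §12.5 p. 183] -/
theorem isClassFunOn_up_of_upDef (μ : HeckeCharacter L)
    [MeasurableSpace ((UnitaryGroup.cmDatum L 2 (Matrix.of fun i j : Fin 2 => if i.val + j.val + 1 = 2 then (1 : L) else 0)).Local v ×
      (UnitaryGroup.cmDatum L 1 (Matrix.of fun i j : Fin 1 => if i.val + j.val + 1 = 1 then (1 : L) else 0)).Local v)]
    (𝔇 : Ch12Sec5.EllipticData (Gqs L v)
      ((UnitaryGroup.cmDatum L 2 (Matrix.of fun i j : Fin 2 => if i.val + j.val + 1 = 2 then (1 : L) else 0)).Local v ×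
        (UnitaryGroup.cmDatum L 1 (Matrix.of fun i j : Fin 1 => if i.val + j.val + 1 = 1 then (1 : L) else 0)).Local v))
    (hUp : ∀ (α : ((UnitaryGroup.cmDatum L 2 (Matrix.of fun i j : Fin 2 => if i.val + j.val + 1 = 2 then (1 : L) else 0)).Local v ×
        (UnitaryGroup.cmDatum L 1 (Matrix.of fun i j : Fin 1 => if i.val + j.val + 1 = 1 then (1 : L) else 0)).Local v) → ℂ) (x : Gqs L v),
      𝔇.up α x =
        if IsRegularElt (x.val : GL (Fin 3) (UnitaryGroup.LocalRing L v)) then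
          ((𝔇.DG x : ℂ))⁻¹ *
            ∑ᶠ q : Quot (IsLocalStablyConjH L v),
              (if IsLocalGRegular L v q.out ∧ IsLocalNormPair L (qsForm L) v q.out x then
                finTau L v q.out μ * (𝔇.DH q.out : ℂ) * ((finKappaAt L v (qsForm L) q.out x : ℤ) : ℂ) * α q.out
              else 0)
        else 0)
    (hDGcl : ∀ x y : Gqs L v, 𝔇.DG (y * x * y⁻¹) = 𝔇.DG x)
    (α : ((UnitaryGroup.cmDatum L 2 (Matrix.of fun i j : Fin 2 => if i.val + j.val + 1 = 2 then (1 : L) else 0)).Local v ×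
        (UnitaryGroup.cmDatum L 1 (Matrix.of fun i j : Fin 1 => if i.val + j.val + 1 = 1 then (1 : L) else 0)).Local v) → ℂ)
    (S : Set (Gqs L v)) : Ch12Sec5.IsClassFunOn S (𝔇.up α) :=
  fun x _ y => up_conj_eq_of_upDef L v μ 𝔇 hUp hDGcl α x y

end Summit.HodgeConjecture.HodgeConjecture.Cruxes.H413.F0P3cStCharTSUpClass

end
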